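import Summits.AtomisticToContinuum.FouriersLaw.Theses.PhononMeanFreePath

/-!
# Disproof attempts on `PhononMeanFreePath.BoundaryKubo` (stmt-AtomisticToContinuum-11812) — findings

Standing adversary file (cdisprove seat `refuter-cdisprove-stmt-AtomisticToContinuum-11812-0`,
cycle 1, 2026-08-16). Prose lives in docstrings; every `theorem` below is checked (no `sorry`).
LANDED COPIES (importable): §0–§5 = `Summits/AtomisticToContinuum/FouriersLaw/Theorems/BoundaryKubo/Negative/LoadBearing.lean`
(p73600), §6 = `…/Negative/Reflection.lean` (p73601, self-contained hypotheses).

## The crux, read back (`boundaryKubo_iff`, `Iff.rfl`)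

`BoundaryKubo` ≡ ∀ ω₂ lam β γ > 0, `UniqueSteady ω₂ lam β γ` (= the route item `NessUnique` at this
parameter point, `nessUnique_iff`) → ∀ steady-state family `μ` (`SteadyFamily`) → ∀ T > 0 → ∀ N,
`IntegrableOn (kuboIntegrand ω₂ lam β γ T N) (Ioi 0)` ∧ `LimitClause ω₂ lam β γ μ T N`, where
`kuboIntegrand … T N t = C_N(t) = Cov_{Gibbs_T}(p_0², K_t p_N²)` for the CONSTRUCTED equal-temperature
kernels `K_t = transitionKernel (N+1) T T t` of the `(N+1)`-site chain and
`LimitClause … μ T N : totalCurrent(μ (N+1) (T+δ/2) (T-δ/2))/δ → kuboValue = N·(γ²/T²)·∫₀^∞ C_N`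
as `δ → 0, δ ≠ 0`.

## Verdict of cycle 1: NO KILL — and why it resists

1. SHAPE OF ANY REFUTATION (`not_boundaryKubo_iff`). `¬ BoundaryKubo` is EQUIVALENT to: at some
   admissible `(ω₂, lam, β, γ)`, weak-NESS uniqueness `UniqueSteady` HOLDS (for all `N, T_L, T_R > 0`
   — this is the open shared item stmt-0741 `NessUnique` at that point) AND some steady family breaks a
   clause. So no refutation can be landed before 0741 is proved at a parameter point; conversely, if
   0741 were false everywhere, `BoundaryKubo` holds vacuously (`boundaryKubo_of_forall_not_unique`).
   A disproof therefore needs (0741 at a point) + (failure of fixed-`N` linear response or of the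
   time-integrability of `C_N`), both of which are believed false (CEHR2018 Harris mixing at fixed `N`;
   Hairer–Majda-type response theory) — the crux is "true but unproved analysis", difficulty L–XL.
2. THE CONSTANT `N·γ²/T²` IS RIGHT. Re-derived on paper by two routes (response in `T_L` alone:
   `∂_{T_L}L = γ∂²_{p_0}`, Gaussian IBP `⟨∂²_{p_0}h⟩_T = T⁻²Cov_T(p_0², h)`, `J̃ = γ(⟨p_N²⟩ - T_R)`,
   antisymmetry `J̃(a,b) = -J̃(b,a)`; and the symmetric protocol `L₁ = (γ/2)(∂²_{p_0} - ∂²_{p_N})`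
   closed by the sum rule `(γ/T²)(∫Cov(p_0²,K_tp_N²) + ∫Cov(p_N²,K_tp_N²)) = ∂_{T_L}⟨p_N²⟩ +
   ∂_{T_R}⟨p_N²⟩ = 1`), agreeing with three earlier independent re-derivations on the item and with
   the printed formal derivation (Kundu–Dhar–Narayan 2009, arXiv:0809.4543: `⟨J⟩_ΔT = Δβ∫⟨J(t)J_fp(0)⟩`,
   `J_fp = (γ/2)[(p_N²-T) - (p_1²-T)]` — the same response operator; our cross form applies it to
   `A = γp_N²` directly, with no continuity-equation step). EXACT at the Gaussian corner `lam = β = 0`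
   (Lyapunov equations, 11 parameter points, `n = 2…6` sites: ratio `D_{N+1}/(Nγ²T⁻²∫C_N) = 1` to
   12 digits — kit jobs of this seat; two earlier exact-rational checks agree). MOLECULAR DYNAMICS AT
   ANHARMONIC POINTS (BAOAB, 4000 replicas, NEMD `totalCurrent/δ` vs the equilibrium Kubo side; jobs
   j014156/7/8, j014422–5, table in the item evidence `MD_RESULTS.md`): ratio NEMD/Kubo = 0.994 ± 0.006
   (`n = 2`), 0.996 ± 0.012 (`n = 3`) at `ω₂ = lam = β = γ = T = 1`; 1.000 ± 0.010 at `(γ, T) = (½, 2)`;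
   0.998 ± 0.009 (`n = 2`) and 1.013 ± 0.008 (`n = 3`, `δ = 0.3` curvature) at `T = 3` (`lam·T = 3`,
   strongly anharmonic); `n = 4`: 0.99–1.00 ± 0.015 once the Kubo window is long enough (τ ≤ 30–40; j014751);
   harmonic MD control reproduces the exact `D_2 = 1/6` to 1 %. Finite-`δ` bias is `O(δ²)` as §6
   predicts (`D(0.15) = 0.2066`, `D(0.3) = 0.208–0.210` at `T = 2`). So the kill criterion "wrong
   constant / missing term / no linear response" does NOT fire anywhere tested: `lam, β > 0` are NOT
   load-bearing for the identity (K) — a proof should work verbatim for `lam, β ≥ 0`, i.e. it is pure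
   fixed-`N` linear response + mixing, nothing anharmonic.
3. `N = 0` IS NOT AN ATTACK SURFACE (`totalCurrent_one_site`, `kuboValue_zero`, `limitClause_zero`):
   the one-site chain has no bond, `totalCurrent = 0`, and the claimed value is `0 · (…) = 0`, so the
   limit clause holds for EVERY family; only `C_0 ∈ L¹(0,∞)` (mixing of one thermostatted quartic
   oscillator, friction `2γ`) remains, true by Harris at fixed `N`.
4. LOAD-BEARING HYPOTHESES, as theorems on the conclusion predicate:
   * stationarity of the family — `limitClause_false_without_steady` (Dirac family at the phase point
     `junkPoint`, current `-(1+β)`, `totalCurrent/δ = -(1+β)/δ` has no limit);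
   * `0 < T` — `limitClause_false_without_T_pos`: for `T ≤ 0` the family hypothesis constrains nothing
     at the temperatures `T ± δ/2` (not both positive), and a steady family re-defined there by the same
     Dirac junk breaks the clause; so `T > 0` enters only through the family hypothesis;
   * `0 < γ` — hidden: at `γ = 0` the temperatures drop out of the generator, Gibbs states at every
     temperature are weak steady states, `UniqueSteady` fails and the crux is vacuous there; but the
     integrability clause is FALSE at `γ = 0` (isolated Hamiltonian chain, no decay of `C_N`) — any
     proof of `C_N ∈ L¹` must use `γ > 0` (mixing), any proof of the limit clause must use uniqueness;
   * `0 < lam`, `0 < β` — NOT load-bearing for (K) (item 2); they matter only for the EXISTENCE theory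
     feeding `SteadyFamily` (CEHR C5, `pinnedChain_exists_isSteadyState` needs `lam, β > 0`).
   * `UniqueSteady` — used twice in every derivation: `μ (N+1) T T = Gibbs_T` (`steadyFamily_apply_self`,
     proved here) and the antisymmetry `J̃(a,b) = -J̃(b,a)` (reflection `i ↦ N-i` + uniqueness; the
     reflection covariance of `OscillatorChain.generator` is NOT in the tree — needed glue).
5. REFORMULATION FOR PROVERS (`limitClause_iff_hasDerivAt`, proved): under the hypotheses
   `totalCurrent(μ (N+1) T T) = 0` (`totalCurrent_apply_self`, from uniqueness + Gibbs stationarity +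
   `pinnedChain_totalCurrent_gibbsMeasure`), hence the limit clause is EXACTLY
   `HasDerivAt (δ ↦ totalCurrent(μ (N+1) (T+δ/2) (T-δ/2))) (N γ²T⁻² ∫₀^∞ C_N) 0` — differentiability
   at `δ = 0` of the steady current along the symmetric protocol, with the Green–Kubo value.
6. NEEDED GLUE, PROVED HERE (§6): site reflection `R : i ↦ N-1-i` is a symmetry —
   `L_{a,b}(f ∘ R) = (L_{b,a}f) ∘ R` (`generator_comp_reflect'`, V even), `j_i ∘ R = -j_{N-2-i}`,
   `totalCurrent(R_* μ) = -totalCurrent(μ)`, `R_*` maps steady states at `(a,b)` to steady states at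
   `(b,a)` (`isSteadyState_map_reflect`); with uniqueness `totalCurrent(μ M b a) = -totalCurrent(μ M a b)`
   (`totalCurrent_antisymm`), so the response quotient is EVEN in `δ` on `|δ| < 2T` and the crux's
   two-sided limit is equivalent to the one-sided limit `δ → 0⁺` (`limitClause_iff_tendsto_nhdsGT`);
   in particular finite-`δ` NEMD estimates of `D_{N+1}` carry an `O(δ²)` (not `O(δ)`) bias.
7. NATURAL STRENGTHENINGS. `N`-uniform boundedness of `D_{N+1}` is the catalogued waypoint
   `HasBoundedResponse` (open for `lam, β > 0`, FALSE at `lam = β = 0`: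
   `HarmonicChainBallisticFlux.not_hasBoundedResponse`, in tree) — not claimed by the crux. Positivity
   `C_N(t) ≥ 0` for all `t` holds at the Gaussian corner (`C_N = 2r_N²`) but is NOT guaranteed at
   `lam, β > 0` (connected 4-point part of either sign); the MD resolves no significant sign change
   (`|min C_N| ≲ 10⁻³ ≈ 2σ_true`) — provers should still not route through pointwise positivity of
   `C_N`. `C_N(0) = 0` exactly (momenta are independent under Gibbs), reproduced numerically.

## Index
§0 read-back · §1 `N = 0` · §2 non-tautology witnesses (Dirac junk family) · §3 what a refutation
must contain · §4 reformulation as a derivative at `δ = 0` · §5 `γ = 0`: uniqueness fails, the crux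
is vacuous there, so `0 < γ` may be weakened to `0 ≤ γ` without changing the statement · §6 reflection
symmetry, antisymmetry of the steady current, one-sided form of the limit clause.
-/

noncomputable section

namespace Summit.AtomisticToContinuum.FouriersLaw.Cruxes.BoundaryKubo.Disproof

open MeasureTheory Filter Topology Set
open Literature.MathematicalPhysics.KineticTheory.HeatConduction
open Summit.AtomisticToContinuum.FouriersLaw.Theses.PhononMeanFreePath (BoundaryKubo NessUnique)

/-! ### §0 Read-back of the crux -/

/-- The Kubo integrand `C_N(t) = Cov_{Gibbs_T}(p_0², K_t p_N²)` of the `(N+1)`-site chain at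
temperature `T` (verbatim sub-term of the crux). [folklore] -/
def kuboIntegrand (ω₂ lam β γ T : ℝ) (N : ℕ) (t : ℝ) : ℝ :=
  (∫ z, (z.2 0) ^ 2 * (∫ y, (y.2 (Fin.last N)) ^ 2
      ∂((pinnedChain ω₂ lam β γ).transitionKernel (N + 1) T T t.toNNReal z))
      ∂((pinnedChain ω₂ lam β γ).gibbsMeasure (N + 1) T)) -
    (∫ z, (z.2 0) ^ 2 ∂((pinnedChain ω₂ lam β γ).gibbsMeasure (N + 1) T)) *
      (∫ z, (∫ y, (y.2 (Fin.last N)) ^ 2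
        ∂((pinnedChain ω₂ lam β γ).transitionKernel (N + 1) T T t.toNNReal z))
        ∂((pinnedChain ω₂ lam β γ).gibbsMeasure (N + 1) T))

/-- The claimed response coefficient `D_{N+1} = N · (γ²/T²) · ∫₀^∞ C_N`. [folklore] -/
def kuboValue (ω₂ lam β γ T : ℝ) (N : ℕ) : ℝ :=
  (N : ℝ) * (γ ^ 2 / T ^ 2) * ∫ t in Ioi (0 : ℝ), kuboIntegrand ω₂ lam β γ T N t

/-- The limit clause of the crux for the family `μ` at `(T, N)`:
`totalCurrent(μ (N+1) (T+δ/2) (T-δ/2))/δ → kuboValue` as `δ → 0`, `δ ≠ 0`. [folklore] -/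
def LimitClause (ω₂ lam β γ : ℝ) (μ : (M : ℕ) → ℝ → ℝ → Measure (PhaseSpace M)) (T : ℝ)
    (N : ℕ) : Prop :=
  Tendsto (fun δ : ℝ =>
      (pinnedChain ω₂ lam β γ).totalCurrent (μ (N + 1) (T + δ / 2) (T - δ / 2)) / δ)
    (𝓝[≠] 0) (𝓝 (kuboValue ω₂ lam β γ T N))

/-- Weak-NESS uniqueness at one parameter point (the hypothesis of the crux = route item
`NessUnique` specialised, `nessUnique_iff`). [folklore] -/
def UniqueSteady (ω₂ lam β γ : ℝ) : Prop :=
  ∀ (N : ℕ) (T_L T_R : ℝ), 0 < T_L → 0 < T_R → ∀ μ ν : Measure (PhaseSpace N),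
    (pinnedChain ω₂ lam β γ).IsSteadyState N T_L T_R μ →
      (pinnedChain ω₂ lam β γ).IsSteadyState N T_L T_R ν → μ = ν

/-- `μ` is a family of weak steady states at all positive bath temperatures. [folklore] -/
def SteadyFamily (ω₂ lam β γ : ℝ) (μ : (M : ℕ) → ℝ → ℝ → Measure (PhaseSpace M)) : Prop :=
  ∀ (N : ℕ) (T_L T_R : ℝ), 0 < T_L → 0 < T_R →
    (pinnedChain ω₂ lam β γ).IsSteadyState N T_L T_R (μ N T_L T_R)

/-- Read-back: the crux is literally the statement assembled from the pieces above. [folklore] -/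
theorem boundaryKubo_iff :
    BoundaryKubo ↔ ∀ ω₂ lam β γ : ℝ, 0 < ω₂ → 0 < lam → 0 < β → 0 < γ →
      UniqueSteady ω₂ lam β γ →
        ∀ μ : (M : ℕ) → ℝ → ℝ → Measure (PhaseSpace M), SteadyFamily ω₂ lam β γ μ →
          ∀ T : ℝ, 0 < T → ∀ N : ℕ,
            IntegrableOn (kuboIntegrand ω₂ lam β γ T N) (Ioi 0) ∧ LimitClause ω₂ lam β γ μ T N :=
  Iff.rfl

/-- The route's support item `NessUnique` is `UniqueSteady` at every admissible point. [folklore] -/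
theorem nessUnique_iff :
    NessUnique ↔ ∀ ω₂ lam β γ : ℝ, 0 < ω₂ → 0 < lam → 0 < β → 0 < γ → UniqueSteady ω₂ lam β γ :=
  Iff.rfl

/-! ### §1 `N = 0`: the one-site chain is not an attack surface -/

/-- A one-site chain has no bond: its total current vanishes for EVERY measure. [folklore] -/
theorem totalCurrent_one_site (P : OscillatorChain) (μ : Measure (PhaseSpace 1)) :
    P.totalCurrent μ = 0 := by
  simp [OscillatorChain.totalCurrent, OscillatorChain.bondCurrent]

/-- … and the claimed value at `N = 0` is `0 · (γ²/T²) · ∫ C_0 = 0`. [folklore] -/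
theorem kuboValue_zero (ω₂ lam β γ T : ℝ) : kuboValue ω₂ lam β γ T 0 = 0 := by
  simp [kuboValue]

/-- Hence the limit clause at `N = 0` holds for every family whatsoever (steady or not): the
`N = 0` instance of the crux reduces to `C_0 ∈ L¹(0,∞)`. [folklore] -/
theorem limitClause_zero (ω₂ lam β γ T : ℝ) (μ : (M : ℕ) → ℝ → ℝ → Measure (PhaseSpace M)) :
    LimitClause ω₂ lam β γ μ T 0 := by
  unfold LimitClause
  simp only [totalCurrent_one_site, zero_div, kuboValue_zero]
  exact tendsto_const_nhds

/-! ### §2 The limit clause is not a tautology: Dirac junk families -/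

/-- The phase point `q_i = i`, `p_i = 1`: every bond is stretched by `1` and carries the current
`j_i = -(p_i + p_{i+1})/2 · V'(1) = -(1 + β)`. [folklore] -/
def junkPoint (M : ℕ) : PhaseSpace M := (fun i => (i.val : ℝ), fun _ => 1)

/-- The two-site chain at `junkPoint` carries total current `-(1 + β)`. [folklore] -/
theorem totalCurrent_dirac_junkPoint (ω₂ lam β γ : ℝ) :
    (pinnedChain ω₂ lam β γ).totalCurrent (Measure.dirac (junkPoint 2)) = -(1 + β) := by
  simp [OscillatorChain.totalCurrent, OscillatorChain.bondCurrent, integral_dirac, junkPoint,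
    Fin.sum_univ_two, pinnedChain_deriv_V]

/-- `c/δ` (`c ≠ 0`) has no finite limit at `δ → 0`: a function eventually equal to it along
`𝓝[≠] 0` does not converge. [folklore] -/
theorem not_tendsto_of_eventuallyEq_const_div {f : ℝ → ℝ} {c L : ℝ} (hc : c ≠ 0)
    (hf : f =ᶠ[𝓝[≠] (0 : ℝ)] fun δ => c / δ) : ¬ Tendsto f (𝓝[≠] 0) (𝓝 L) := by
  intro h
  have hid : Tendsto (fun δ : ℝ => δ) (𝓝[≠] (0 : ℝ)) (𝓝 0) :=
    tendsto_nhdsWithin_of_tendsto_nhds tendsto_id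
  have h1 : Tendsto (fun δ : ℝ => f δ * δ) (𝓝[≠] 0) (𝓝 (L * 0)) := h.mul hid
  have h2 : (fun δ : ℝ => f δ * δ) =ᶠ[𝓝[≠] (0 : ℝ)] fun _ => c := by
    filter_upwards [hf, self_mem_nhdsWithin] with δ hδ hne
    rw [hδ, div_mul_cancel₀ c (Set.mem_compl_singleton_iff.mp hne)]
  have h3 : Tendsto (fun _ : ℝ => c) (𝓝[≠] (0 : ℝ)) (𝓝 (L * 0)) := h1.congr' h2
  rw [mul_zero] at h3
  exact hc (tendsto_nhds_unique h3 tendsto_const_nhds ▸ rfl)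

/-- **Stationarity is load-bearing.** Without the steady-state hypothesis on the family the limit
clause fails (any `β ≥ 0`, any other parameters): for the Dirac family at `junkPoint`,
`totalCurrent/δ = -(1+β)/δ` diverges. [folklore] -/
theorem limitClause_false_without_steady (ω₂ lam γ T : ℝ) {β : ℝ} (hβ : 0 ≤ β) :
    ¬ ∀ μ : (M : ℕ) → ℝ → ℝ → Measure (PhaseSpace M), LimitClause ω₂ lam β γ μ T 1 := by
  intro h
  have h1 := h fun M _ _ => Measure.dirac (junkPoint M)
  unfold LimitClause at h1
  change Tendsto (fun δ : ℝ =>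
      (pinnedChain ω₂ lam β γ).totalCurrent (Measure.dirac (junkPoint 2)) / δ) (𝓝[≠] 0) _ at h1
  simp only [totalCurrent_dirac_junkPoint] at h1
  exact not_tendsto_of_eventuallyEq_const_div (c := -(1 + β)) (by linarith) EventuallyEq.rfl h1

/-- **`0 < T` is load-bearing only through the family hypothesis.** For `T ≤ 0` the two bath
temperatures `T ± δ/2` are never both positive, so `SteadyFamily` says nothing there: re-defining
any steady family (one exists, `pinnedChain_exists_isSteadyState`) as the Dirac junk at
non-positive temperatures keeps it steady and breaks the limit clause at `N = 1`. [folklore] -/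
theorem limitClause_false_without_T_pos {ω₂ lam β γ : ℝ} (hω : 0 < ω₂) (hl : 0 < lam)
    (hβ : 0 < β) (hγ : 0 < γ) {T : ℝ} (hT : T ≤ 0) :
    ∃ μ : (M : ℕ) → ℝ → ℝ → Measure (PhaseSpace M),
      SteadyFamily ω₂ lam β γ μ ∧ ¬ LimitClause ω₂ lam β γ μ T 1 := by
  classical
  choose ν hν using fun (M : ℕ) (a b : ℝ) (ha : 0 < a) (hb : 0 < b) =>
    pinnedChain_exists_isSteadyState hω hl hβ hγ M ha hb
  let μ : (M : ℕ) → ℝ → ℝ → Measure (PhaseSpace M) := fun M a b =>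
    if h : 0 < a ∧ 0 < b then ν M a b h.1 h.2 else Measure.dirac (junkPoint M)
  refine ⟨μ, fun M a b ha hb => ?_, fun hlim => ?_⟩
  · show (pinnedChain ω₂ lam β γ).IsSteadyState M a b
      (if h : 0 < a ∧ 0 < b then ν M a b h.1 h.2 else Measure.dirac (junkPoint M))
    rw [dif_pos ⟨ha, hb⟩]
    exact hν M a b ha hb
  · unfold LimitClause at hlim
    have hev : (fun δ : ℝ => (pinnedChain ω₂ lam β γ).totalCurrent
        (μ (1 + 1) (T + δ / 2) (T - δ / 2)) / δ) = fun δ => (-(1 + β)) / δ := by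
      funext δ
      have hnot : ¬ (0 < T + δ / 2 ∧ 0 < T - δ / 2) := fun h => by linarith [h.1, h.2]
      show (pinnedChain ω₂ lam β γ).totalCurrent
          (if h : 0 < T + δ / 2 ∧ 0 < T - δ / 2 then ν 2 (T + δ / 2) (T - δ / 2) h.1 h.2
            else Measure.dirac (junkPoint 2)) / δ = _
      rw [dif_neg hnot, totalCurrent_dirac_junkPoint]
    rw [hev] at hlim
    exact not_tendsto_of_eventuallyEq_const_div (c := -(1 + β)) (by linarith) EventuallyEq.rfl hlim

/-! ### §3 What a refutation must contain -/

/-- **Shape of any refutation.** `¬ BoundaryKubo` holds iff at some admissible parameter point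
weak-NESS uniqueness (`UniqueSteady`, the open item stmt-0741 there) HOLDS and some steady family
breaks the integrability or the limit clause at some `T > 0`, `N`. In particular no refutation can
be landed without a proof of stmt-0741 at a parameter point. [folklore] -/
theorem not_boundaryKubo_iff :
    ¬ BoundaryKubo ↔ ∃ ω₂ lam β γ : ℝ, 0 < ω₂ ∧ 0 < lam ∧ 0 < β ∧ 0 < γ ∧
      UniqueSteady ω₂ lam β γ ∧
        ∃ μ : (M : ℕ) → ℝ → ℝ → Measure (PhaseSpace M), SteadyFamily ω₂ lam β γ μ ∧
          ∃ T : ℝ, 0 < T ∧ ∃ N : ℕ,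
            ¬ (IntegrableOn (kuboIntegrand ω₂ lam β γ T N) (Ioi 0) ∧
                LimitClause ω₂ lam β γ μ T N) := by
  rw [boundaryKubo_iff]
  push Not
  rfl

/-- Dually: if weak-NESS uniqueness failed at EVERY admissible point, the crux would hold
vacuously — its content is entirely conditional on stmt-0741. [folklore] -/
theorem boundaryKubo_of_forall_not_unique
    (h : ∀ ω₂ lam β γ : ℝ, 0 < ω₂ → 0 < lam → 0 < β → 0 < γ → ¬ UniqueSteady ω₂ lam β γ) :
    BoundaryKubo := by
  rw [boundaryKubo_iff]
  intro ω₂ lam β γ hω hl hβ hγ hU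
  exact absurd hU (h ω₂ lam β γ hω hl hβ hγ)

/-! ### §4 Reformulation: the crux is differentiability of the steady current at `δ = 0` -/

/-- Under uniqueness, the member of a steady family at equal temperatures IS the Gibbs state
(`pinnedChain_isSteadyState_gibbsMeasure`). [folklore] -/
theorem steadyFamily_apply_self {ω₂ lam β γ : ℝ} (hω : 0 < ω₂) (hl : 0 < lam) (hβ : 0 < β)
    (hU : UniqueSteady ω₂ lam β γ) {μ : (M : ℕ) → ℝ → ℝ → Measure (PhaseSpace M)}
    (hμ : SteadyFamily ω₂ lam β γ μ) {T : ℝ} (hT : 0 < T) (M : ℕ) :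
    μ M T T = (pinnedChain ω₂ lam β γ).gibbsMeasure M T :=
  hU M T T hT hT _ _ (hμ M T T hT hT) (pinnedChain_isSteadyState_gibbsMeasure hω hl.le hβ.le γ M hT)

/-- … so at `δ = 0` the steady current of the family vanishes (no current at equilibrium,
`pinnedChain_totalCurrent_gibbsMeasure`). [folklore] -/
theorem totalCurrent_apply_self {ω₂ lam β γ : ℝ} (hω : 0 < ω₂) (hl : 0 < lam) (hβ : 0 < β)
    (hU : UniqueSteady ω₂ lam β γ) {μ : (M : ℕ) → ℝ → ℝ → Measure (PhaseSpace M)}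
    (hμ : SteadyFamily ω₂ lam β γ μ) {T : ℝ} (hT : 0 < T) (M : ℕ) :
    (pinnedChain ω₂ lam β γ).totalCurrent (μ M T T) = 0 := by
  rw [steadyFamily_apply_self hω hl hβ hU hμ hT M]
  exact pinnedChain_totalCurrent_gibbsMeasure ω₂ lam β γ M T

/-- **The limit clause is exactly a derivative at `δ = 0`.** Under the hypotheses of the crux
(uniqueness, steady family, `T > 0`), `LimitClause` at `(T, N)` holds iff the steady total current
along the symmetric protocol `δ ↦ totalCurrent(μ (N+1) (T+δ/2) (T-δ/2))` (which vanishes at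
`δ = 0`) has derivative `N·(γ²/T²)·∫₀^∞ C_N` at `0`. [folklore] -/
theorem limitClause_iff_hasDerivAt {ω₂ lam β γ : ℝ} (hω : 0 < ω₂) (hl : 0 < lam) (hβ : 0 < β)
    (hU : UniqueSteady ω₂ lam β γ) {μ : (M : ℕ) → ℝ → ℝ → Measure (PhaseSpace M)}
    (hμ : SteadyFamily ω₂ lam β γ μ) {T : ℝ} (hT : 0 < T) (N : ℕ) :
    LimitClause ω₂ lam β γ μ T N ↔
      HasDerivAt (fun δ : ℝ =>
          (pinnedChain ω₂ lam β γ).totalCurrent (μ (N + 1) (T + δ / 2) (T - δ / 2)))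
        (kuboValue ω₂ lam β γ T N) 0 := by
  rw [hasDerivAt_iff_tendsto_slope_zero, LimitClause]
  have h0 : (pinnedChain ω₂ lam β γ).totalCurrent (μ (N + 1) (T + 0 / 2) (T - 0 / 2)) = 0 := by
    rw [zero_div, add_zero, sub_zero]
    exact totalCurrent_apply_self hω hl hβ hU hμ hT (N + 1)
  have hfun : (fun t : ℝ => t⁻¹ • ((pinnedChain ω₂ lam β γ).totalCurrent
        (μ (N + 1) (T + (0 + t) / 2) (T - (0 + t) / 2)) -
        (pinnedChain ω₂ lam β γ).totalCurrent (μ (N + 1) (T + 0 / 2) (T - 0 / 2)))) =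
      fun δ : ℝ => (pinnedChain ω₂ lam β γ).totalCurrent (μ (N + 1) (T + δ / 2) (T - δ / 2)) / δ := by
    funext t
    rw [h0, sub_zero, zero_add, smul_eq_mul, inv_mul_eq_div]
  rw [hfun]

/-! ### §5 `γ = 0`: the crux is vacuous on the isolated chain — `0 < γ` hides behind uniqueness -/

/-- At `γ = 0` the bath temperatures drop out of the generator. [folklore] -/
theorem generator_gamma_zero (ω₂ lam β : ℝ) (N : ℕ) (a b a' b' : ℝ) (f : PhaseSpace N → ℝ)
    (x : PhaseSpace N) :
    (pinnedChain ω₂ lam β 0).generator N a b f x =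
      (pinnedChain ω₂ lam β 0).generator N a' b' f x := by
  simp [OscillatorChain.generator, pinnedChain]

/-- … so at `γ = 0` the weak steady-state class is temperature-blind. [folklore] -/
theorem isSteadyState_gamma_zero_iff (ω₂ lam β : ℝ) (N : ℕ) (a b a' b' : ℝ)
    (μ : Measure (PhaseSpace N)) :
    (pinnedChain ω₂ lam β 0).IsSteadyState N a b μ ↔
      (pinnedChain ω₂ lam β 0).IsSteadyState N a' b' μ := by
  unfold OscillatorChain.IsSteadyState
  simp_rw [generator_gamma_zero ω₂ lam β N a b a' b']

/-- `∂Φ/∂q_i (0) = 0`: the origin is a rest point of the pinned chain. [folklore] -/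
theorem dPotential_zero (ω₂ lam β γ : ℝ) (N : ℕ) (i : Fin N) :
    (pinnedChain ω₂ lam β γ).dPotential N i 0 = 0 := by
  simp [OscillatorChain.dPotential, pinnedChain_deriv_U, pinnedChain_deriv_V]

/-- The pinning potential of `pinnedChain` is differentiable. [folklore] -/
theorem differentiable_U (ω₂ lam β γ : ℝ) : Differentiable ℝ (pinnedChain ω₂ lam β γ).U := by
  show Differentiable ℝ fun q : ℝ => ω₂ * q ^ 2 / 2 + lam * q ^ 4 / 4
  fun_prop

/-- The interaction potential of `pinnedChain` is differentiable. [folklore] -/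
theorem differentiable_V (ω₂ lam β γ : ℝ) : Differentiable ℝ (pinnedChain ω₂ lam β γ).V := by
  show Differentiable ℝ fun r : ℝ => r ^ 2 / 2 + β * r ^ 4 / 4
  fun_prop

/-- At `γ = 0` the Dirac mass at the rest point `(q, p) = 0` is a weak steady state for EVERY
nominal pair of bath temperatures (`L f (0) = 0` since `p = 0` and `∂_q H(0) = 0`). [folklore] -/
theorem isSteadyState_dirac_zero (ω₂ lam β : ℝ) (N : ℕ) (a b : ℝ) :
    (pinnedChain ω₂ lam β 0).IsSteadyState N a b (Measure.dirac 0) := by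
  refine ⟨inferInstance, fun f _ _ => ?_, fun i => ?_⟩
  · rw [integral_dirac]
    have hq : ∀ i : Fin N, partialQ i ((pinnedChain ω₂ lam β 0).hamiltonian N) 0 = 0 := fun i => by
      rw [OscillatorChain.partialQ_hamiltonian_eq_dPotential _ (differentiable_U ω₂ lam β 0)
        (differentiable_V ω₂ lam β 0)]
      exact dPotential_zero ω₂ lam β 0 N i
    have hγ : (pinnedChain ω₂ lam β 0).γ = 0 := rfl
    simp [OscillatorChain.generator, hq, hγ]
  · exact (integrable_const ((pinnedChain ω₂ lam β 0).bondCurrent N i 0)).congr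
      (ae_eq_dirac ((pinnedChain ω₂ lam β 0).bondCurrent N i)).symm

/-- Points are Lebesgue-null in the one-site phase space. [folklore] -/
theorem volume_singleton_phaseSpace_one (x : PhaseSpace 1) :
    volume ({x} : Set (PhaseSpace 1)) = 0 := by
  rw [MeasureTheory.Measure.volume_eq_prod]
  exact measure_singleton x

/-- **Weak-NESS uniqueness FAILS at `γ = 0`** (`ω₂ > 0`, `lam, β ≥ 0`): on one site at
`T_L = T_R = 1` both the Dirac mass at rest and the Gibbs state (`pinnedChain_isSteadyState_gibbsMeasure`,
absolutely continuous) are weak steady states, and they differ on `{0}`. [folklore] -/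
theorem not_uniqueSteady_gamma_zero {ω₂ lam β : ℝ} (hω : 0 < ω₂) (hl : 0 ≤ lam) (hβ : 0 ≤ β) :
    ¬ UniqueSteady ω₂ lam β 0 := by
  intro hU
  have h := hU 1 1 1 one_pos one_pos _ _ (isSteadyState_dirac_zero ω₂ lam β 1 1 1)
    (pinnedChain_isSteadyState_gibbsMeasure hω hl hβ 0 1 one_pos)
  have h1 : (Measure.dirac (0 : PhaseSpace 1)) {0} = 1 := by simp
  have h2 : (pinnedChain ω₂ lam β 0).gibbsMeasure 1 1 {0} = 0 :=
    (pinnedChain ω₂ lam β 0).gibbsMeasure_absolutelyContinuous 1 1 (volume_singleton_phaseSpace_one 0)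
  rw [h, h2] at h1
  exact zero_ne_one h1

/-- **`0 < γ` is not load-bearing for the crux AS STATED**: weakening it to `0 ≤ γ` gives an
equivalent statement, because at `γ = 0` the uniqueness antecedent fails and the body holds
vacuously — although physically `γ > 0` is essential (at `γ = 0` the chain is isolated, `C_N` does
not decay and the integrability clause is false; not formalised: needs the identification of
`transitionKernel` at `γ = 0` with the deterministic flow). Moral for provers: `γ > 0` enters a proof
of `BoundaryKubo` only through uniqueness/mixing, never through the algebra of the identity. [folklore] -/
theorem boundaryKubo_iff_gamma_nonneg :
    BoundaryKubo ↔ ∀ ω₂ lam β γ : ℝ, 0 < ω₂ → 0 < lam → 0 < β → 0 ≤ γ →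
      UniqueSteady ω₂ lam β γ →
        ∀ μ : (M : ℕ) → ℝ → ℝ → Measure (PhaseSpace M), SteadyFamily ω₂ lam β γ μ →
          ∀ T : ℝ, 0 < T → ∀ N : ℕ,
            IntegrableOn (kuboIntegrand ω₂ lam β γ T N) (Ioi 0) ∧ LimitClause ω₂ lam β γ μ T N := by
  rw [boundaryKubo_iff]
  refine ⟨fun h ω₂ lam β γ hω hl hβ hγ hU => ?_, fun h ω₂ lam β γ hω hl hβ hγ => h ω₂ lam β γ hω hl hβ hγ.le⟩
  rcases hγ.lt_or_eq with hγ' | hγ'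
  · exact h ω₂ lam β γ hω hl hβ hγ' hU
  · subst hγ'
    exact absurd hU (not_uniqueSteady_gamma_zero hω hl.le hβ.le)

/-! ### §6 Needed glue, proved: reflection symmetry, antisymmetry of the steady current, and the
one-sided form of the limit clause -/

section Reflection
variable {N : ℕ}

/-- Site reflection `i ↦ N-1-i` of positions and momenta, as a continuous linear automorphism of
phase space (an involution). [folklore] -/
def reflectCLE (N : ℕ) : PhaseSpace N ≃L[ℝ] PhaseSpace N :=
  ((LinearEquiv.funCongrLeft ℝ ℝ Fin.revPerm).prodCongr
    (LinearEquiv.funCongrLeft ℝ ℝ Fin.revPerm)).toContinuousLinearEquiv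

/-- Reflected positions. [folklore] -/
@[simp] theorem reflectCLE_fst (x : PhaseSpace N) (i : Fin N) : (reflectCLE N x).1 i = x.1 (Fin.rev i) := rfl
/-- Reflected momenta. [folklore] -/
@[simp] theorem reflectCLE_snd (x : PhaseSpace N) (i : Fin N) : (reflectCLE N x).2 i = x.2 (Fin.rev i) := rfl

/-- Reflection is an involution. [folklore] -/
@[simp] theorem reflectCLE_reflectCLE (x : PhaseSpace N) : reflectCLE N (reflectCLE N x) = x := by
  ext i <;> simp

/-- Line derivatives of `f ∘ R` are line derivatives of `f` along reflected directions (no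
differentiability needed: both sides are `deriv`s of the same one-variable function). [folklore] -/
theorem lineDeriv_comp_reflect (f : PhaseSpace N → ℝ) (x v : PhaseSpace N) :
    lineDeriv ℝ (f ∘ reflectCLE N) x v = lineDeriv ℝ f (reflectCLE N x) (reflectCLE N v) := by
  unfold lineDeriv
  simp only [Function.comp_apply, map_add, map_smul]

/-- Reflection permutes the position coordinate directions. [folklore] -/
theorem reflect_unitQ (i : Fin N) :
    reflectCLE N ((Pi.single i 1, 0) : PhaseSpace N) = (Pi.single (Fin.rev i) 1, 0) := by
  ext j
  · simp only [reflectCLE_fst, Pi.single_apply]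
    by_cases h : j = Fin.rev i
    · subst h; simp
    · have : Fin.rev j ≠ i := fun h' => h (by rw [← h', Fin.rev_rev])
      simp [h, this]
  · simp

/-- Reflection permutes the momentum coordinate directions. [folklore] -/
theorem reflect_unitP (i : Fin N) :
    reflectCLE N ((0, Pi.single i 1) : PhaseSpace N) = (0, Pi.single (Fin.rev i) 1) := by
  ext j
  · simp
  · simp only [reflectCLE_snd, Pi.single_apply]
    by_cases h : j = Fin.rev i
    · subst h; simp
    · have : Fin.rev j ≠ i := fun h' => h (by rw [← h', Fin.rev_rev])
      simp [h, this]

/-- `∂_{q_i}(f ∘ R) = (∂_{q_{N-1-i}} f) ∘ R`. [folklore] -/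
theorem partialQ_comp_reflect (i : Fin N) (f : PhaseSpace N → ℝ) (x : PhaseSpace N) :
    partialQ i (f ∘ reflectCLE N) x = partialQ (Fin.rev i) f (reflectCLE N x) := by
  rw [partialQ_eq_lineDeriv, partialQ_eq_lineDeriv, lineDeriv_comp_reflect, reflect_unitQ]

/-- `∂_{p_i}(f ∘ R) = (∂_{p_{N-1-i}} f) ∘ R`. [folklore] -/
theorem partialP_comp_reflect (i : Fin N) (f : PhaseSpace N → ℝ) (x : PhaseSpace N) :
    partialP i (f ∘ reflectCLE N) x = partialP (Fin.rev i) f (reflectCLE N x) := by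
  rw [partialP_eq_lineDeriv, partialP_eq_lineDeriv, lineDeriv_comp_reflect, reflect_unitP]

/-- `∂²_{p_i}(f ∘ R) = (∂²_{p_{N-1-i}} f) ∘ R`. [folklore] -/
theorem partialP_partialP_comp_reflect (i : Fin N) (f : PhaseSpace N → ℝ) (x : PhaseSpace N) :
    partialP i (partialP i (f ∘ reflectCLE N)) x =
      partialP (Fin.rev i) (partialP (Fin.rev i) f) (reflectCLE N x) := by
  have h : partialP i (f ∘ reflectCLE N) = partialP (Fin.rev i) f ∘ reflectCLE N :=
    funext (partialP_comp_reflect i f)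
  rw [h, partialP_comp_reflect]

/-- The Hamiltonian is reflection invariant when the interaction is even. [folklore] -/
theorem hamiltonian_reflect (P : OscillatorChain) (hV : ∀ r, P.V (-r) = P.V r) (x : PhaseSpace N) :
    P.hamiltonian N (reflectCLE N x) = P.hamiltonian N x := by
  unfold OscillatorChain.hamiltonian
  simp only [reflectCLE_fst, reflectCLE_snd]
  congr 1
  · exact Equiv.sum_comp Fin.revPerm (fun i => x.2 i ^ 2 / 2 + P.U (x.1 i))
  · calc (∑ i : Fin N, ∑ j : Fin N,
          if j.val = i.val + 1 then P.V (x.1 (Fin.rev j) - x.1 (Fin.rev i)) else 0)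
        = ∑ i : Fin N, ∑ j : Fin N,
          if (Fin.rev j).val = (Fin.rev i).val + 1 then P.V (x.1 j - x.1 i) else 0 := by
          rw [← Equiv.sum_comp Fin.revPerm]
          refine Finset.sum_congr rfl fun i _ => ?_
          rw [← Equiv.sum_comp Fin.revPerm]
          refine Finset.sum_congr rfl fun j _ => ?_
          simp [Fin.rev_rev]
      _ = ∑ i : Fin N, ∑ j : Fin N, if i.val = j.val + 1 then P.V (x.1 j - x.1 i) else 0 := by
          refine Finset.sum_congr rfl fun i _ => Finset.sum_congr rfl fun j _ => ?_
          have hij : ((Fin.rev j).val = (Fin.rev i).val + 1) ↔ (i.val = j.val + 1) := by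
            rw [Fin.val_rev, Fin.val_rev]; omega
          rw [if_congr hij rfl rfl]
      _ = ∑ j : Fin N, ∑ i : Fin N, if i.val = j.val + 1 then P.V (x.1 j - x.1 i) else 0 :=
          Finset.sum_comm
      _ = _ := by
          refine Finset.sum_congr rfl fun i _ => Finset.sum_congr rfl fun j _ => ?_
          split_ifs
          · rw [← hV, neg_sub]
          · rfl

/-- Reflection covariance of the generator: `L_{a,b}(f ∘ R) = (L_{b,a} f) ∘ R`. [folklore] -/
theorem generator_comp_reflect (P : OscillatorChain) (hV : ∀ r, P.V (-r) = P.V r) (a b : ℝ)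
    (f : PhaseSpace N → ℝ) (y : PhaseSpace N) :
    P.generator N a b (f ∘ reflectCLE N) (reflectCLE N y) = P.generator N b a f y := by
  have hH : P.hamiltonian N ∘ reflectCLE N = P.hamiltonian N := funext (hamiltonian_reflect P hV)
  have hQH : ∀ i, partialQ i (P.hamiltonian N) (reflectCLE N y) =
      partialQ (Fin.rev i) (P.hamiltonian N) y := by
    intro i
    rw [← reflectCLE_reflectCLE y, ← partialQ_comp_reflect, hH, reflectCLE_reflectCLE]
  unfold OscillatorChain.generator
  simp only [partialQ_comp_reflect, partialP_comp_reflect, partialP_partialP_comp_reflect, hQH,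
    reflectCLE_reflectCLE, reflectCLE_snd]
  congr 1
  · exact Equiv.sum_comp Fin.revPerm
      (fun i => y.2 i * partialQ i f y - partialQ i (P.hamiltonian N) y * partialP i f y)
  · congr 1
    rw [← Equiv.sum_comp Fin.revPerm]
    refine Finset.sum_congr rfl fun j _ => ?_
    have h0 : ((Fin.rev j).val = 0) ↔ (j.val = N - 1) := by rw [Fin.val_rev]; omega
    have h1 : ((Fin.rev j).val = N - 1) ↔ (j.val = 0) := by rw [Fin.val_rev]; omega
    simp only [Fin.revPerm_apply, Fin.rev_rev]
    rw [if_congr h0 rfl rfl, if_congr h1 rfl rfl, add_comm]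

/-- Reflection covariance of the generator, unprimed form: `L_{a,b}(f ∘ R)(x) = L_{b,a} f (R x)`. [folklore] -/
theorem generator_comp_reflect' (P : OscillatorChain) (hV : ∀ r, P.V (-r) = P.V r) (a b : ℝ)
    (f : PhaseSpace N → ℝ) (x : PhaseSpace N) :
    P.generator N a b (f ∘ reflectCLE N) x = P.generator N b a f (reflectCLE N x) := by
  rw [← reflectCLE_reflectCLE x, generator_comp_reflect P hV, reflectCLE_reflectCLE]


/-- Reflection is a measurable embedding (a homeomorphism). [folklore] -/
theorem measurableEmbedding_reflect : MeasurableEmbedding (reflectCLE N) :=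
  (reflectCLE N).toHomeomorph.measurableEmbedding

/-- Closed form of the bond current on a genuine bond `(i, i+1)`. [folklore] -/
theorem bondCurrent_eq_of_lt (P : OscillatorChain) {i : Fin N} (h : i.val + 1 < N)
    (x : PhaseSpace N) :
    P.bondCurrent N i x =
      -((x.2 i + x.2 ⟨i.val + 1, h⟩) / 2 * deriv P.V (x.1 ⟨i.val + 1, h⟩ - x.1 i)) := by
  unfold OscillatorChain.bondCurrent
  rw [Finset.sum_eq_single ⟨i.val + 1, h⟩]
  · simp
  · intro j _ hj
    rw [if_neg]
    intro hv
    exact hj (Fin.ext hv)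
  · intro h'
    exact absurd (Finset.mem_univ _) h'

/-- No bond starts at the last site. [folklore] -/
theorem bondCurrent_eq_zero_of_not_lt (P : OscillatorChain) {i : Fin N} (h : ¬ i.val + 1 < N)
    (x : PhaseSpace N) : P.bondCurrent N i x = 0 := by
  unfold OscillatorChain.bondCurrent
  refine Finset.sum_eq_zero fun j _ => ?_
  rw [if_neg]
  intro hv
  exact h (hv ▸ j.isLt)

/-- The bond reflection `(i, i+1) ↦ (N-2-i, N-1-i)` (identity on the dummy last index). [folklore] -/
def bondRev (N : ℕ) (i : Fin N) : Fin N :=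
  if h : i.val + 1 < N then ⟨N - 2 - i.val, by omega⟩ else i

/-- Value of the bond reflection on a genuine bond. [folklore] -/
theorem bondRev_val_of_lt {i : Fin N} (h : i.val + 1 < N) : (bondRev N i).val = N - 2 - i.val := by
  simp [bondRev, h]

/-- The bond reflection fixes the dummy last index. [folklore] -/
theorem bondRev_of_not_lt {i : Fin N} (h : ¬ i.val + 1 < N) : bondRev N i = i := by
  simp [bondRev, h]

/-- The bond reflection is an involution. [folklore] -/
theorem bondRev_involutive : Function.Involutive (bondRev N) := by
  intro i
  by_cases h : i.val + 1 < N
  · have h2 : (bondRev N i).val + 1 < N := by rw [bondRev_val_of_lt h]; omega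
    apply Fin.ext
    rw [bondRev_val_of_lt h2, bondRev_val_of_lt h]
    omega
  · rw [bondRev_of_not_lt h, bondRev_of_not_lt h]

/-- The bond reflection as a permutation of `Fin N`. [folklore] -/
def bondRevPerm (N : ℕ) : Equiv.Perm (Fin N) := bondRev_involutive.toPerm (bondRev N)

/-- Unfolding `bondRevPerm`. [folklore] -/
@[simp] theorem bondRevPerm_apply (i : Fin N) : bondRevPerm N i = bondRev N i := rfl

/-- The force of an even interaction is odd (`deriv_comp_neg`, no differentiability needed). [folklore] -/
theorem deriv_V_neg (P : OscillatorChain) (hV : ∀ r, P.V (-r) = P.V r) (r : ℝ) :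
    deriv P.V (-r) = -deriv P.V r := by
  have h : P.V = fun s => P.V (-s) := funext fun s => (hV s).symm
  conv_lhs => rw [h]
  rw [deriv_comp_neg, neg_neg]

/-- Reflection reverses bond currents (for an even interaction, whose force is odd). [folklore] -/
theorem bondCurrent_reflect (P : OscillatorChain) (hV : ∀ r, P.V (-r) = P.V r) (i : Fin N)
    (x : PhaseSpace N) :
    P.bondCurrent N i (reflectCLE N x) = -P.bondCurrent N (bondRev N i) x := by
  by_cases h : i.val + 1 < N
  · have hk : (bondRev N i).val + 1 < N := by rw [bondRev_val_of_lt h]; omega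
    rw [bondCurrent_eq_of_lt P h, bondCurrent_eq_of_lt P hk]
    have e1 : Fin.rev i = ⟨(bondRev N i).val + 1, hk⟩ :=
      Fin.ext (by rw [Fin.val_rev]; simp only [bondRev_val_of_lt h]; omega)
    have e2 : Fin.rev (⟨i.val + 1, h⟩ : Fin N) = bondRev N i :=
      Fin.ext (by rw [Fin.val_rev, bondRev_val_of_lt h]; simp only; omega)
    simp only [reflectCLE_fst, reflectCLE_snd, e1, e2]
    rw [show x.1 (bondRev N i) - x.1 ⟨(bondRev N i).val + 1, hk⟩ =
        -(x.1 ⟨(bondRev N i).val + 1, hk⟩ - x.1 (bondRev N i)) by ring, deriv_V_neg P hV]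
    ring
  · rw [bondRev_of_not_lt h, bondCurrent_eq_zero_of_not_lt P h, bondCurrent_eq_zero_of_not_lt P h,
      neg_zero]

/-- Reflection reverses the total current of any measure. [folklore] -/
theorem totalCurrent_map_reflect (P : OscillatorChain) (hV : ∀ r, P.V (-r) = P.V r)
    (μ : Measure (PhaseSpace N)) :
    P.totalCurrent (μ.map (reflectCLE N)) = -P.totalCurrent μ := by
  unfold OscillatorChain.totalCurrent
  have hmap : ∀ i, ∫ x, P.bondCurrent N i x ∂(μ.map (reflectCLE N)) =
      -∫ x, P.bondCurrent N (bondRev N i) x ∂μ := by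
    intro i
    rw [measurableEmbedding_reflect.integral_map]
    simp_rw [bondCurrent_reflect P hV]
    exact integral_neg _
  simp_rw [hmap]
  rw [Finset.sum_neg_distrib]
  congr 1
  exact Equiv.sum_comp (bondRevPerm N) (fun i => ∫ x, P.bondCurrent N i x ∂μ)

/-- Reflection maps steady states at `(T_L, T_R) = (a, b)` to steady states at `(b, a)`. [folklore] -/
theorem isSteadyState_map_reflect (P : OscillatorChain) (hV : ∀ r, P.V (-r) = P.V r) {a b : ℝ}
    {μ : Measure (PhaseSpace N)} (h : P.IsSteadyState N a b μ) :
    P.IsSteadyState N b a (μ.map (reflectCLE N)) := by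
  obtain ⟨hprob, hgen, hint⟩ := h
  refine ⟨Measure.isProbabilityMeasure_map (reflectCLE N).continuous.measurable.aemeasurable,
    fun f hf hfc => ?_, fun i => ?_⟩
  · rw [measurableEmbedding_reflect.integral_map]
    simp_rw [← generator_comp_reflect' P hV a b f]
    exact hgen _ (hf.comp (reflectCLE N).contDiff) (hfc.comp_homeomorph (reflectCLE N).toHomeomorph)
  · rw [measurableEmbedding_reflect.integrable_map_iff]
    have hf : P.bondCurrent N i ∘ reflectCLE N = fun x => -P.bondCurrent N (bondRev N i) x :=
      funext fun x => bondCurrent_reflect P hV i x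
    rw [hf]
    exact (hint _).neg

/-- The FPU-β interaction of `pinnedChain` is even. [folklore] -/
theorem pinnedChain_V_even (ω₂ lam β γ r : ℝ) :
    (pinnedChain ω₂ lam β γ).V (-r) = (pinnedChain ω₂ lam β γ).V r := by
  show (-r) ^ 2 / 2 + β * (-r) ^ 4 / 4 = r ^ 2 / 2 + β * r ^ 4 / 4
  ring


/-- **Antisymmetry of the steady current** under exchange of the bath temperatures (reflection
symmetry + uniqueness). [folklore] -/
theorem totalCurrent_antisymm {ω₂ lam β γ : ℝ} (hU : UniqueSteady ω₂ lam β γ)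
    {μ : (M : ℕ) → ℝ → ℝ → Measure (PhaseSpace M)} (hμ : SteadyFamily ω₂ lam β γ μ)
    {a b : ℝ} (ha : 0 < a) (hb : 0 < b) (M : ℕ) :
    (pinnedChain ω₂ lam β γ).totalCurrent (μ M b a) =
      -(pinnedChain ω₂ lam β γ).totalCurrent (μ M a b) := by
  have h1 := isSteadyState_map_reflect _ (pinnedChain_V_even ω₂ lam β γ) (hμ M a b ha hb)
  have h2 : μ M b a = (μ M a b).map (reflectCLE M) := hU M b a hb ha _ _ (hμ M b a hb ha) h1
  rw [h2, totalCurrent_map_reflect _ (pinnedChain_V_even ω₂ lam β γ)]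

/-- Hence the response quotient `δ ↦ totalCurrent(μ (N+1) (T+δ/2) (T-δ/2))/δ` is EVEN on `|δ| < 2T`. [folklore] -/
theorem responseQuotient_neg {ω₂ lam β γ : ℝ} (hU : UniqueSteady ω₂ lam β γ)
    {μ : (M : ℕ) → ℝ → ℝ → Measure (PhaseSpace M)} (hμ : SteadyFamily ω₂ lam β γ μ)
    {T δ : ℝ} (hδ : |δ| < 2 * T) (M : ℕ) :
    (pinnedChain ω₂ lam β γ).totalCurrent (μ M (T + -δ / 2) (T - -δ / 2)) / -δ =
      (pinnedChain ω₂ lam β γ).totalCurrent (μ M (T + δ / 2) (T - δ / 2)) / δ := by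
  have hlt := abs_lt.mp hδ
  have ha : 0 < T + δ / 2 := by linarith
  have hb : 0 < T - δ / 2 := by linarith
  rw [show T + -δ / 2 = T - δ / 2 by ring, show T - -δ / 2 = T + δ / 2 by ring,
    totalCurrent_antisymm hU hμ ha hb M, neg_div_neg_eq]

/-- … so the two-sided response limit of the crux is EQUIVALENT to the one-sided limit `δ → 0⁺`. [folklore] -/
theorem tendsto_responseQuotient_iff {ω₂ lam β γ : ℝ} (hU : UniqueSteady ω₂ lam β γ)
    {μ : (M : ℕ) → ℝ → ℝ → Measure (PhaseSpace M)} (hμ : SteadyFamily ω₂ lam β γ μ)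
    {T : ℝ} (hT : 0 < T) (M : ℕ) (K : ℝ) :
    Tendsto (fun δ : ℝ =>
        (pinnedChain ω₂ lam β γ).totalCurrent (μ M (T + δ / 2) (T - δ / 2)) / δ) (𝓝[≠] 0) (𝓝 K) ↔
      Tendsto (fun δ : ℝ =>
        (pinnedChain ω₂ lam β γ).totalCurrent (μ M (T + δ / 2) (T - δ / 2)) / δ) (𝓝[>] 0) (𝓝 K) := by
  set g : ℝ → ℝ := fun δ =>
    (pinnedChain ω₂ lam β γ).totalCurrent (μ M (T + δ / 2) (T - δ / 2)) / δ with hg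
  constructor
  · intro h
    exact h.mono_left (nhdsWithin_mono _ fun x hx => ne_of_gt hx)
  · intro h
    have hneg0 : Tendsto (fun δ : ℝ => -δ) (𝓝[<] (0 : ℝ)) (𝓝[>] (0 : ℝ)) := by
      rw [tendsto_nhdsWithin_iff]
      constructor
      · have : Tendsto (fun δ : ℝ => -δ) (𝓝 (0 : ℝ)) (𝓝 (0 : ℝ)) := by
          simpa using (continuous_neg.tendsto (0 : ℝ))
        exact this.mono_left nhdsWithin_le_nhds
      · filter_upwards [self_mem_nhdsWithin] with δ hδ
        exact neg_pos.mpr (Set.mem_Iio.mp hδ)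
    have hneg : Tendsto (fun δ : ℝ => g (-δ)) (𝓝[<] (0 : ℝ)) (𝓝 K) := h.comp hneg0
    have hev : (fun δ : ℝ => g (-δ)) =ᶠ[𝓝[<] (0 : ℝ)] g := by
      filter_upwards [Ioo_mem_nhdsLT (show -(2 * T) < 0 by linarith)] with δ hδ
      simp only [hg]
      exact responseQuotient_neg hU hμ (abs_lt.mpr ⟨hδ.1, by linarith [hδ.2]⟩) M
    have hlt : Tendsto g (𝓝[<] (0 : ℝ)) (𝓝 K) := hneg.congr' hev
    rw [← nhdsLT_sup_nhdsGT]
    exact hlt.sup h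


/-- **The limit clause is equivalent to its one-sided version** (`δ → 0⁺`): under uniqueness the
response quotient is even in `δ`, so provers may restrict to `T_L > T_R`. [folklore] -/
theorem limitClause_iff_tendsto_nhdsGT {ω₂ lam β γ : ℝ} (hU : UniqueSteady ω₂ lam β γ)
    {μ : (M : ℕ) → ℝ → ℝ → Measure (PhaseSpace M)} (hμ : SteadyFamily ω₂ lam β γ μ)
    {T : ℝ} (hT : 0 < T) (N : ℕ) :
    LimitClause ω₂ lam β γ μ T N ↔
      Tendsto (fun δ : ℝ =>
        (pinnedChain ω₂ lam β γ).totalCurrent (μ (N + 1) (T + δ / 2) (T - δ / 2)) / δ)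
        (𝓝[>] 0) (𝓝 (kuboValue ω₂ lam β γ T N)) :=
  tendsto_responseQuotient_iff hU hμ hT (N + 1) _

end Reflection

end Summit.AtomisticToContinuum.FouriersLaw.Cruxes.BoundaryKubo.Disproof
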